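import Summits.HodgeConjecture.CorCM.StabiliserOrbitKernel
import HarnessLib

/-!
# ONE STABILISER ORBIT: the pair is additive iff the orbit multiplicities of the partner type are not constant and
# unequal — fibres (towers) and reflex incidence (reflex partners) at once; zero orbits; pair-flip bases

COR-CM (cell `pub-hodgecm2`, binder seat `b16` gen 53, count-neutral claim ORBIT-CRITERION, file F2 — abstract `G`-set
level; theorems only, no definition, no named fact, no `sorry`).  NEW as stated, hence under `Summits/`.  HONEST FRAMING:
finite-dimensional linear algebra about the Kubota–Dodson rank of families of CM types and its reading on products of CM
abelian varieties; `HC_CM` is neither used nor asserted.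

F1 (`StabiliserOrbitKernel`) proved: for `U(Φ_{i₀})` irreducible and sets `O_j ⊆ E_{i₁}` homogeneous under `Stab(x₀)`,
separated, with pointwise partial conjugations off `⋃_j (O_j ∪ ρO_j)`, the pair `(Φ_{i₀}, Φ_{i₁})` is additive iff
`u_1(Φ_{i₀})(g x₀)` is not a rational combination of the orbit shadows `g ↦ Σ_{y∈O_j} u_1(Φ_{i₁})(g y)`.  This file reads
the criterion for ONE orbit `O` (the generic situation: ONE conjugation-odd orbit pair `{O, ρO}`):

* §1 **`orbitParallel_iff_exists_multiplicities`** — `u_1(Φ₀)(g x₀) = c · Σ_{y∈O} u_1(Φ₁)(g y)` for all `g` IFF the ORBIT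
  MULTIPLICITIES `N(g) = #{y ∈ O : g y ∈ Φ₁}` are CONSTANT AND UNEQUAL: `N(g) = a` when `g x₀ ∈ Φ₀`, `= b` when
  `g x₀ ∉ Φ₀`, `a ≠ b` (then `a + b = #O`, `c = 1/(a − b)`).  For `O = r⁻¹x₀` the fibre of an equivariant `r : Y → X`
  this is Yanai's condition «`Φ₁` lies over `Φ₀` with constant multiplicities» (gen 52 `parallel_iff_exists_multiplicities`,
  Gordon 9.4.3); for `O =` the reflex type inside the reflex slot it is gen 45's Hamming-ball condition (sequel F4).
* §2 **`forall_map_le_iff_not_exists_orbitMultiplicities`** — `I = {i₀, i₁}`, `U(Φ_{i₀})` irreducible, `Stab(x₀)`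
  transitive on `O ⊆ E_{i₁}`, pointwise partial conjugations off `O ∪ ρO`: ADDITIVE (`Hg(A₀ × A₁) = Hg(A₀) × Hg(A₁)`) IFF
  the orbit multiplicities are NOT constant-unequal; rank form `typeRank_sigmaType_add_card_eq_iff_not_exists_orbitMultiplicities`,
  nondegeneracy form `typeRank_sigmaType_eq_iff_not_exists_orbitMultiplicities`, pair-flip base
  `typeRank_sigmaType_eq_iff_of_pairFlip_of_orbit` (irreducibility and nondegeneracy of the base from pair flips).
  `typeRank_sigmaType_add_card_lt_of_orbitMultiplicities`: constant unequal orbit multiplicities on ANY `Stab(x₀)`-stable…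
  indeed on ANY set `O` make the pair degenerate (no hypothesis at all on `O`).
* §3 ZERO orbits: `forall_map_le_of_pointwise_offEmpty` — pointwise partial conjugations at EVERY `y` (one base point
  `x₀`) give additivity (the `κ = ∅` case of F1; gen 48's `pairwise_of_pointwiseConj_basePoint` is the stronger form
  without irreducibility).  `stab_transitive_fibre`: for an equivariant `r : Y → X` and `G` transitive on `Y`, `Stab(x₀)`
  is transitive on the fibre `r⁻¹x₀` — so gen 52's F6 is the instance `O = r⁻¹x₀` of §2.

## References

* [Gordon1999HodgeAVSurvey] B. B. Gordon, *A survey of the Hodge conjecture for abelian varieties*, §3 Theorem (Imai,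
  Murty) with proof, 7.5–7.7, 9.4.3 (Yanai).
* [Serre1977] J.-P. Serre, *Linear Representations of Finite Groups*, GTM 42, §2.2, §7.2–7.4.
* [Dodson1984] B. Dodson, *The structure of Galois groups of CM-fields*, Trans. AMS 283 (1984), §1.1, §3.3.2, §5.1.2.
-/

set_option autoImplicit false

noncomputable section

open scoped BigOperators

universe u v

namespace Summit.HodgeConjecture.CorCM.Shadow

open Literature.NumberTheory.ComplexMultiplication
open scoped Classical

variable {G : Type u} [Group G]

/-! ### §1 One orbit: parallel orbit shadow ⟺ constant unequal orbit multiplicities -/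

section OneOrbit

variable {X Y : Type*} [MulAction G X] [MulAction G Y] [Fintype Y]

/-- The orbit multiplicities of `g` and `ρ g` are complementary: `#{y ∈ O : ρ g y ∈ Φ₁} = #O − #{y ∈ O : g y ∈ Φ₁}`.
[folklore] -/
theorem card_orbitMult_rho_mul {ρ : G} {Φ₁ : Set Y} (h₁ : IsCMTypeWith ρ Φ₁) (O : Set Y) (g : G) :
    ((Finset.univ.filter fun y : Y => y ∈ O ∧ (ρ * g) • y ∈ Φ₁).card : ℚ) =
      (Finset.univ.filter fun y : Y => y ∈ O).card - (Finset.univ.filter fun y : Y => y ∈ O ∧ g • y ∈ Φ₁).card := by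
  have h := Finset.card_filter_add_card_filter_not (s := Finset.univ.filter fun y : Y => y ∈ O)
    (fun y : Y => g • y ∈ Φ₁)
  rw [Finset.filter_filter, Finset.filter_filter] at h
  have h2 : (Finset.univ.filter fun y : Y => y ∈ O ∧ (ρ * g) • y ∈ Φ₁) =
      Finset.univ.filter fun y : Y => y ∈ O ∧ ¬ g • y ∈ Φ₁ := by
    refine Finset.filter_congr fun y _ => ?_
    rw [mul_smul, h₁.rho_smul_mem_iff]
  rw [h2]
  have h3 : ((Finset.univ.filter fun y : Y => y ∈ O ∧ g • y ∈ Φ₁).card : ℚ) +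
      (Finset.univ.filter fun y : Y => y ∈ O ∧ ¬ g • y ∈ Φ₁).card = (Finset.univ.filter fun y : Y => y ∈ O).card := by
    exact_mod_cast h
  linarith

/-- **Parallel orbit shadow ⟺ constant unequal orbit multiplicities.**  `Φ₀ ⊆ X`, `Φ₁ ⊆ Y` CM types for `ρ`, `x₀ ∈ X`,
`O ⊆ Y` ANY set: `u_1(Φ₀)(g x₀) = c · Σ_{y ∈ O} u_1(Φ₁)(g y)` for all `g ∈ G` (some `c ∈ ℚ`) IFF there are `a ≠ b` with
`#{y ∈ O : g y ∈ Φ₁} = a` whenever `g x₀ ∈ Φ₀` and `= b` whenever `g x₀ ∉ Φ₀` (and then `a + b = #O`, `c = 1/(a − b)`).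
[cite: Gordon1999HodgeAVSurvey, 9.4.3] -/
theorem orbitParallel_iff_exists_multiplicities {ρ : G} {Φ₀ : Set X} {Φ₁ : Set Y} (h₀ : IsCMTypeWith ρ Φ₀)
    (h₁ : IsCMTypeWith ρ Φ₁) (x₀ : X) (O : Set Y) :
    (∃ c : ℚ, ∀ g : G, antiVec Φ₀ (1 : G) (g • x₀) =
        c * ∑ y ∈ Finset.univ.filter (fun y : Y => y ∈ O), antiVec Φ₁ (1 : G) (g • y)) ↔
      ∃ a b : ℕ, a ≠ b ∧ ∀ g : G,
        (Finset.univ.filter fun y : Y => y ∈ O ∧ g • y ∈ Φ₁).card = if g • x₀ ∈ Φ₀ then a else b := by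
  -- two reference elements: one moving `x₀` into `Φ₀`, one moving it out
  obtain ⟨g₁, hg₁⟩ : ∃ g : G, g • x₀ ∈ Φ₀ := by
    by_cases hx : x₀ ∈ Φ₀
    · exact ⟨1, by rwa [one_smul]⟩
    · exact ⟨ρ, (h₀.rho_smul_mem_iff x₀).2 hx⟩
  obtain ⟨g₂, hg₂⟩ : ∃ g : G, g • x₀ ∉ Φ₀ := by
    by_cases hx : x₀ ∈ Φ₀
    · exact ⟨ρ, fun h => (h₀.rho_smul_mem_iff x₀).1 h hx⟩
    · exact ⟨1, by rwa [one_smul]⟩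
  constructor
  · rintro ⟨c, hc⟩
    have hval : ∀ g : G, (if g • x₀ ∈ Φ₀ then (1 : ℚ) else -1) =
        c * (2 * ((Finset.univ.filter fun y : Y => y ∈ O ∧ g • y ∈ Φ₁).card : ℚ) -
          ((Finset.univ.filter fun y : Y => y ∈ O).card : ℚ)) := by
      intro g
      have h3 := hc g
      rw [antiVec_one_eq_ite, orbitSum_antiVec_one_eq] at h3
      exact h3
    have h1 := hval g₁
    have h2 := hval g₂
    rw [if_pos hg₁] at h1
    rw [if_neg hg₂] at h2
    have hc0 : c ≠ 0 := by
      rintro rfl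
      rw [zero_mul] at h1
      exact one_ne_zero h1
    refine ⟨(Finset.univ.filter fun y : Y => y ∈ O ∧ g₁ • y ∈ Φ₁).card,
      (Finset.univ.filter fun y : Y => y ∈ O ∧ g₂ • y ∈ Φ₁).card, fun hab => ?_, fun g => ?_⟩
    · rw [hab] at h1
      linarith
    · have h3 := hval g
      by_cases hg : g • x₀ ∈ Φ₀
      · rw [if_pos hg] at h3 ⊢
        have h4 : c * (2 * ((Finset.univ.filter fun y : Y => y ∈ O ∧ g • y ∈ Φ₁).card : ℚ)) =
            c * (2 * ((Finset.univ.filter fun y : Y => y ∈ O ∧ g₁ • y ∈ Φ₁).card : ℚ)) := by linarith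
        exact_mod_cast mul_left_cancel₀ two_ne_zero (mul_left_cancel₀ hc0 h4)
      · rw [if_neg hg] at h3 ⊢
        have h4 : c * (2 * ((Finset.univ.filter fun y : Y => y ∈ O ∧ g • y ∈ Φ₁).card : ℚ)) =
            c * (2 * ((Finset.univ.filter fun y : Y => y ∈ O ∧ g₂ • y ∈ Φ₁).card : ℚ)) := by linarith
        exact_mod_cast mul_left_cancel₀ two_ne_zero (mul_left_cancel₀ hc0 h4)
  · rintro ⟨a, b, hab, hN⟩
    -- `a + b = #O` from the pair `g₁`, `ρ g₁`
    have hρg₁ : (ρ * g₁) • x₀ ∉ Φ₀ := by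
      rw [mul_smul]
      exact fun h => (h₀.rho_smul_mem_iff _).1 h hg₁
    have ha := hN g₁
    have hb := hN (ρ * g₁)
    rw [if_pos hg₁] at ha
    rw [if_neg hρg₁] at hb
    have hsum : ((a : ℚ) + b) = (Finset.univ.filter fun y : Y => y ∈ O).card := by
      have h := card_orbitMult_rho_mul h₁ O g₁
      rw [ha, hb] at h
      linarith
    have hab' : (a : ℚ) - b ≠ 0 := by
      rw [sub_ne_zero]
      exact_mod_cast hab
    refine ⟨1 / ((a : ℚ) - b), fun g => ?_⟩
    rw [antiVec_one_eq_ite, orbitSum_antiVec_one_eq, hN g, ← hsum]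
    by_cases hg : g • x₀ ∈ Φ₀
    · rw [if_pos hg, if_pos hg]
      field_simp
      ring
    · rw [if_neg hg, if_neg hg]
      field_simp
      ring

end OneOrbit

/-! ### §2 Families: the exact criterion for one orbit -/

section Family

variable {I : Type v} {E : I → Type v} [∀ i, MulAction G (E i)] [DecidableEq I] [Fintype I] [∀ i, Fintype (E i)]
  {ρ : G} {Φ : ∀ i, Set (E i)} {i₀ i₁ : I} [Nonempty I] [∀ i, Nonempty (E i)]

omit [DecidableEq I] in
/-- **Constant unequal orbit multiplicities make the pair degenerate** — for ANY set `O ⊆ E_{i₁}` (no homogeneity, no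
conjugation hypothesis): `rank(Σ) + |I| < Σ_i rank(Φ_i) + 1`. [cite: Gordon1999HodgeAVSurvey, §3 Theorem (proof), 7.5 and 9.4.3] -/
theorem typeRank_sigmaType_add_card_lt_of_orbitMultiplicities (h : ∀ i, IsCMTypeWith ρ (Φ i)) (h01 : i₀ ≠ i₁)
    {x₀ : E i₀} (O : Set (E i₁)) {a b : ℕ} (hab : a ≠ b)
    (hN : ∀ g : G, (Finset.univ.filter fun y : E i₁ => y ∈ O ∧ g • y ∈ Φ i₁).card = if g • x₀ ∈ Φ i₀ then a else b) :
    typeRank G (sigmaType Φ) + Fintype.card I < (∑ i, typeRank G (Φ i)) + 1 := by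
  obtain ⟨c, hc⟩ := (orbitParallel_iff_exists_multiplicities (h i₀) (h i₁) x₀ O).2 ⟨a, b, hab, hN⟩
  refine typeRank_sigmaType_add_card_lt_of_orbitCoeff h h01 (x₀ := x₀) (κ := Unit) (fun _ => O) (c := fun _ => c)
    fun g => ?_
  rw [Fintype.sum_unique]
  exact hc g

omit [DecidableEq I] [Fintype I] [∀ i, Fintype (E i)] [Nonempty I] [∀ i, Nonempty (E i)] in
/-- One orbit as a one-member orbit family: the F1 hypotheses. [folklore] -/
theorem orbitFamily_unit {x₀ : E i₀} (O : Set (E i₁))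
    (hO : ∀ y ∈ O, ∀ y' ∈ O, ∃ g : G, g • x₀ = x₀ ∧ g • y = y')
    (hoff : ∀ y : E i₁, y ∉ O → ρ • y ∉ O → ∃ σ : G, σ • x₀ = ρ • x₀ ∧ σ • y = y) :
    (∀ j : Unit, ∀ y ∈ (fun _ : Unit => O) j, ∀ y' ∈ (fun _ : Unit => O) j, ∃ g : G, g • x₀ = x₀ ∧ g • y = y') ∧
      (∀ j j' : Unit, j ≠ j' → ∀ y ∈ (fun _ : Unit => O) j,
        y ∉ (fun _ : Unit => O) j' ∧ ρ • y ∉ (fun _ : Unit => O) j') ∧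
      (∀ y : E i₁, (∀ j : Unit, y ∉ (fun _ : Unit => O) j ∧ ρ • y ∉ (fun _ : Unit => O) j) →
        ∃ σ : G, σ • x₀ = ρ • x₀ ∧ σ • y = y) :=
  ⟨fun _ => hO, fun j j' hjj' => absurd (Subsingleton.elim j j') hjj', fun y hy => hoff y (hy ()).1 (hy ()).2⟩

omit [DecidableEq I] [Fintype I] [Nonempty I] [∀ i, Nonempty (E i)] in
/-- Orbit constants on a one-member family are one constant. [folklore] -/
theorem exists_orbitCoeff_unit_iff {x₀ : E i₀} (O : Set (E i₁)) :
    (∃ c : Unit → ℚ, ∀ g : G, antiVec (Φ i₀) (1 : G) (g • x₀) =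
        ∑ j, c j * ∑ y ∈ Finset.univ.filter (fun y : E i₁ => y ∈ (fun _ : Unit => O) j),
          antiVec (Φ i₁) (1 : G) (g • y)) ↔
      ∃ c : ℚ, ∀ g : G, antiVec (Φ i₀) (1 : G) (g • x₀) =
        c * ∑ y ∈ Finset.univ.filter (fun y : E i₁ => y ∈ O), antiVec (Φ i₁) (1 : G) (g • y) := by
  constructor
  · rintro ⟨c, hc⟩
    refine ⟨c (), fun g => ?_⟩
    rw [hc g, Fintype.sum_unique]
  · rintro ⟨c, hc⟩
    refine ⟨fun _ => c, fun g => ?_⟩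
    rw [hc g, Fintype.sum_unique]

/-- **THE ONE-ORBIT CRITERION.**  `I = {i₀, i₁}`, `U(Φ_{i₀})` irreducible, `x₀ ∈ E_{i₀}`, `O ⊆ E_{i₁}` homogeneous under
`Stab(x₀)`, every point off `O ∪ ρO` with a pointwise partial conjugation: both slot extensions lie in `U(Σ)`
(`Hg(A₀ × A₁) = Hg(A₀) × Hg(A₁)`) IFF the orbit multiplicities `#{y ∈ O : g y ∈ Φ_{i₁}}` are NOT constant and unequal
according to `g x₀ ∈ Φ_{i₀}`. [cite: Gordon1999HodgeAVSurvey, §3 Theorem, 7.5–7.7 and 9.4.3] [cite: Serre1977, §2.2 and §7.2] -/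
theorem forall_map_le_iff_not_exists_orbitMultiplicities (h : ∀ i, IsCMTypeWith ρ (Φ i)) (hI : ∀ j, j = i₀ ∨ j = i₁)
    (h01 : i₀ ≠ i₁)
    (hirr : ∀ W : Submodule ℚ (E i₀ → ℚ), W ≤ antiSpan G (Φ i₀) → W ≠ ⊥ →
      (∀ (k : G) (f : E i₀ → ℚ), f ∈ W → (fun y => f (k • y)) ∈ W) → W = antiSpan G (Φ i₀))
    {x₀ : E i₀} (O : Set (E i₁)) (hO : ∀ y ∈ O, ∀ y' ∈ O, ∃ g : G, g • x₀ = x₀ ∧ g • y = y')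
    (hoff : ∀ y : E i₁, y ∉ O → ρ • y ∉ O → ∃ σ : G, σ • x₀ = ρ • x₀ ∧ σ • y = y) :
    (∀ i, (antiSpan G (Φ i)).map (slotExt i) ≤ antiSpan G (sigmaType Φ)) ↔
      ¬ ∃ a b : ℕ, a ≠ b ∧ ∀ g : G,
        (Finset.univ.filter fun y : E i₁ => y ∈ O ∧ g • y ∈ Φ i₁).card = if g • x₀ ∈ Φ i₀ then a else b := by
  obtain ⟨hO', hdisj', hoff'⟩ := orbitFamily_unit (ρ := ρ) O hO hoff
  rw [forall_map_le_iff_not_exists_orbitCoeff h hI h01 hirr (fun _ : Unit => O) hO' hdisj' hoff',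
    exists_orbitCoeff_unit_iff, orbitParallel_iff_exists_multiplicities (h i₀) (h i₁) x₀ O]

/-- **Rank form of the one-orbit criterion**: `rank(Σ) + |I| = Σ_i rank(Φ_i) + 1` IFF the orbit multiplicities are not
constant-unequal. [cite: Gordon1999HodgeAVSurvey, §3 Theorem (1), 7.5–7.7 and 9.4.3] -/
theorem typeRank_sigmaType_add_card_eq_iff_not_exists_orbitMultiplicities (h : ∀ i, IsCMTypeWith ρ (Φ i))
    (hI : ∀ j, j = i₀ ∨ j = i₁) (h01 : i₀ ≠ i₁)
    (hirr : ∀ W : Submodule ℚ (E i₀ → ℚ), W ≤ antiSpan G (Φ i₀) → W ≠ ⊥ →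
      (∀ (k : G) (f : E i₀ → ℚ), f ∈ W → (fun y => f (k • y)) ∈ W) → W = antiSpan G (Φ i₀))
    {x₀ : E i₀} (O : Set (E i₁)) (hO : ∀ y ∈ O, ∀ y' ∈ O, ∃ g : G, g • x₀ = x₀ ∧ g • y = y')
    (hoff : ∀ y : E i₁, y ∉ O → ρ • y ∉ O → ∃ σ : G, σ • x₀ = ρ • x₀ ∧ σ • y = y) :
    typeRank G (sigmaType Φ) + Fintype.card I = (∑ i, typeRank G (Φ i)) + 1 ↔
      ¬ ∃ a b : ℕ, a ≠ b ∧ ∀ g : G,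
        (Finset.univ.filter fun y : E i₁ => y ∈ O ∧ g • y ∈ Φ i₁).card = if g • x₀ ∈ Φ i₀ then a else b := by
  obtain ⟨hO', hdisj', hoff'⟩ := orbitFamily_unit (ρ := ρ) O hO hoff
  rw [typeRank_sigmaType_add_card_eq_iff_not_exists_orbitCoeff h hI h01 hirr (fun _ : Unit => O) hO' hdisj' hoff',
    exists_orbitCoeff_unit_iff, orbitParallel_iff_exists_multiplicities (h i₀) (h i₁) x₀ O]

/-- **Nondegeneracy form of the one-orbit criterion**: with `Φ_{i₀}` nondegenerate, `Σ` is nondegenerate IFF `Φ_{i₁}`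
is nondegenerate and its orbit multiplicities are not constant-unequal.
[cite: Gordon1999HodgeAVSurvey, 7.5–7.7 and 9.4.3] -/
theorem typeRank_sigmaType_eq_iff_not_exists_orbitMultiplicities (h : ∀ i, IsCMTypeWith ρ (Φ i))
    (hI : ∀ j, j = i₀ ∨ j = i₁) (h01 : i₀ ≠ i₁)
    (hirr : ∀ W : Submodule ℚ (E i₀ → ℚ), W ≤ antiSpan G (Φ i₀) → W ≠ ⊥ →
      (∀ (k : G) (f : E i₀ → ℚ), f ∈ W → (fun y => f (k • y)) ∈ W) → W = antiSpan G (Φ i₀))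
    (hnd₀ : typeRank G (Φ i₀) = Fintype.card (E i₀) / 2 + 1)
    {x₀ : E i₀} (O : Set (E i₁)) (hO : ∀ y ∈ O, ∀ y' ∈ O, ∃ g : G, g • x₀ = x₀ ∧ g • y = y')
    (hoff : ∀ y : E i₁, y ∉ O → ρ • y ∉ O → ∃ σ : G, σ • x₀ = ρ • x₀ ∧ σ • y = y) :
    typeRank G (sigmaType Φ) = Fintype.card (Σ i, E i) / 2 + 1 ↔
      typeRank G (Φ i₁) = Fintype.card (E i₁) / 2 + 1 ∧
        ¬ ∃ a b : ℕ, a ≠ b ∧ ∀ g : G,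
          (Finset.univ.filter fun y : E i₁ => y ∈ O ∧ g • y ∈ Φ i₁).card = if g • x₀ ∈ Φ i₀ then a else b := by
  obtain ⟨hO', hdisj', hoff'⟩ := orbitFamily_unit (ρ := ρ) O hO hoff
  rw [typeRank_sigmaType_eq_iff_not_exists_orbitCoeff h hI h01 hirr hnd₀ (fun _ : Unit => O) hO' hdisj' hoff',
    exists_orbitCoeff_unit_iff, orbitParallel_iff_exists_multiplicities (h i₀) (h i₁) x₀ O]

/-- **Pair-flip base, one orbit**: if the base slot has pair flips (so `U(Φ_{i₀})` is irreducible and `Φ_{i₀}`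
nondegenerate), `Stab(x₀)` is transitive on `O` and the points off `O ∪ ρO` carry pointwise partial conjugations, then
`Σ` is nondegenerate IFF `Φ_{i₁}` is nondegenerate and its orbit multiplicities are not constant-unequal.
[cite: Dodson1984, §5.1.2] [cite: Gordon1999HodgeAVSurvey, 7.5–7.7 and 9.4.3] -/
theorem typeRank_sigmaType_eq_iff_of_pairFlip_of_orbit [MulAction.IsPretransitive G (E i₀)]
    (h : ∀ i, IsCMTypeWith ρ (Φ i)) (hI : ∀ j, j = i₀ ∨ j = i₁) (h01 : i₀ ≠ i₁)
    (hflip : ∀ x : E i₀, ∃ φ : G, φ • x = ρ • x ∧ ∀ x' : E i₀, x' ≠ x → x' ≠ ρ • x → φ • x' = x')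
    {x₀ : E i₀} (O : Set (E i₁)) (hO : ∀ y ∈ O, ∀ y' ∈ O, ∃ g : G, g • x₀ = x₀ ∧ g • y = y')
    (hoff : ∀ y : E i₁, y ∉ O → ρ • y ∉ O → ∃ σ : G, σ • x₀ = ρ • x₀ ∧ σ • y = y) :
    typeRank G (sigmaType Φ) = Fintype.card (Σ i, E i) / 2 + 1 ↔
      typeRank G (Φ i₁) = Fintype.card (E i₁) / 2 + 1 ∧
        ¬ ∃ a b : ℕ, a ≠ b ∧ ∀ g : G,
          (Finset.univ.filter fun y : E i₁ => y ∈ O ∧ g • y ∈ Φ i₁).card = if g • x₀ ∈ Φ i₀ then a else b :=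
  typeRank_sigmaType_eq_iff_not_exists_orbitMultiplicities h hI h01
    (antiSpan_irreducible_of_pairFlip (h i₀) hflip) (typeRank_eq_of_pairFlip (h i₀) hflip) O hO hoff

/-! ### §3 Zero orbits, and fibres as orbits -/

/-- **ZERO orbits: pointwise partial conjugations at every point give additivity** (the `κ = ∅` case of F1: the would-be
combination is empty, while `u_1(Φ_{i₀})(x₀) = ±1 ≠ 0`; gen 48's `pairwise_of_pointwiseConj_basePoint` is the stronger
form without irreducibility). [cite: Gordon1999HodgeAVSurvey, §3 Theorem (proof)] -/
theorem forall_map_le_of_pointwise_offEmpty (h : ∀ i, IsCMTypeWith ρ (Φ i)) (hI : ∀ j, j = i₀ ∨ j = i₁)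
    (h01 : i₀ ≠ i₁)
    (hirr : ∀ W : Submodule ℚ (E i₀ → ℚ), W ≤ antiSpan G (Φ i₀) → W ≠ ⊥ →
      (∀ (k : G) (f : E i₀ → ℚ), f ∈ W → (fun y => f (k • y)) ∈ W) → W = antiSpan G (Φ i₀))
    {x₀ : E i₀} (hpc : ∀ y : E i₁, ∃ σ : G, σ • x₀ = ρ • x₀ ∧ σ • y = y) :
    ∀ i, (antiSpan G (Φ i)).map (slotExt i) ≤ antiSpan G (sigmaType Φ) := by
  refine (forall_map_le_iff_not_exists_orbitCoeff h hI h01 hirr (κ := Fin 0) (fun j => Fin.elim0 j)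
    (fun j => Fin.elim0 j) (fun j => Fin.elim0 j) (fun y _ => hpc y)).2 ?_
  rintro ⟨c, hc⟩
  have h1 := hc 1
  rw [Finset.univ_eq_empty, Finset.sum_empty, one_smul] at h1
  exact antiVec_ne_zero (Φ i₀) (1 : G) x₀ h1

omit [DecidableEq I] [Fintype I] [Nonempty I] [∀ i, Nonempty (E i)] [∀ i, Fintype (E i)] in
/-- **Fibres are stabiliser orbits**: for an equivariant `r : E_{i₁} → E_{i₀}` and `G` transitive on `E_{i₁}`, `Stab(x₀)`
is transitive on `r⁻¹x₀` — so gen 52's fibre criterion (`RelativePairFlipPointwise`) is the instance `O = r⁻¹x₀` of §2.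
[folklore] -/
theorem stab_transitive_fibre [MulAction.IsPretransitive G (E i₁)] (r : E i₁ → E i₀)
    (hr : ∀ (g : G) (y : E i₁), r (g • y) = g • r y) (x₀ : E i₀) :
    ∀ y ∈ {y : E i₁ | r y = x₀}, ∀ y' ∈ {y : E i₁ | r y = x₀}, ∃ g : G, g • x₀ = x₀ ∧ g • y = y' := by
  intro y hy y' hy'
  obtain ⟨g, hg⟩ := MulAction.exists_smul_eq G y y'
  refine ⟨g, ?_, hg⟩
  rw [Set.mem_setOf_eq] at hy hy'
  rw [← hy, ← hr, hg, hy', hy]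

end Family

end Summit.HodgeConjecture.CorCM.Shadow

end
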